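import Summits.Ventures.QEDPrecision.SpectralMajorants.EndPiece
import HarnessLib

/-!
# The certificate's four quantities as integrals of `F_Q` over `[0,1]`, and the partition into sub-intervals
(venture QEDPrecision, cell `pub-qed`, literature seat, gen 13; folder `SpectralMajorants/`, file 6)

HONEST FRAMING (verbatim, venture QEDPrecision): independent recomputation; certified where stated,
statistical where stated; no new-physics claim.

## What this file is

The assembly skeleton of the I(b)/I(c) certificate's outer quadrature (gl_bounds.md §3.1/§3.4, "Per quantity:
enclosure = Σ_k Σ_i W F(X) ± Σ_k R_{Q,k} ± E_Q"), kernel side: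

* IDENTIFICATION: the typed objects ARE integrals of the real integrand `fQre` of file 4 over `[0,1]`:
  `setIcRep = ∫₀¹ fQre 1 0 2`, `setIbRep = ∫₀¹ fQre 3 2 1`, `groupIbEightRep (C₈) = ∫₀¹ fQre 2 1 1`,
  `seqInsertion rho4 1 1 (C₆) = ∫₀¹ fQre 1 0 1`;
* INTEGRABILITY: `fQre c m n` is continuous on `(0,1)` (`K`, `J₄` are traces of the analytic `kC`, `jC`) and
  dominated by `c(1/3)^m(19/2)^n (1−x)lnᴺ(1/(1−x))` (file 5), hence interval-integrable on `[0,1]` and on every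
  sub-interval;
* PARTITION: for ANY chain `0 = a₀, a₁, …, a_K = 1` in `[0,1]`, `∫₀¹ F_Q = Σ_{k<K} ∫_{a_k}^{a_{k+1}} F_Q`; in
  particular for the certificate's dyadic chain `a_k = 1 − 2^{−k}` (`k ≤ J`), `a_{J+1} = 1`
  (`I₁ = [0,½]`, `I_k = [1−2^{1−k}, 1−2^{−k}]`, end piece `[1−2^{−J}, 1]`): `setIcRep = Σ_{k ≤ J} ∫_{a_k}^{a_{k+1}} (1−x)J₄²`
  and likewise for I(b), C₈, C₆ — each summand being bounded against its Gauss–Legendre sum by `gl_remainder_*`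
  (file 4, k < J) or a priori by `endPiece_*` (file 5, k = J).

So the ONLY inputs of the certificate's enclosures that are not kernel statements are the interval values of
`F_Q` at the Gauss–Legendre nodes (the engine's inner `t`-enclosures of `J₄`, gl_bounds.md §4) and the interval
arithmetic of the sums.  No number moves; not an R-row.  NEW WORK of the cell (elementary analysis about the
cell's typed objects), not a published result; nothing here is cited as a fact anywhere; no numerical value of
any anomaly integral is asserted.
-/

noncomputable section

open Real Set MeasureTheory intervalIntegral Finset

namespace Summit.Ventures.QEDPrecision.SpectralMajorants

open Literature.MathematicalPhysics.QuantumFieldTheory.Jegerlehner2017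

/-! ### Identification of the four quantities -/

/-- `setIcRep = ∫₀¹ F_{I(c)}`. -/
theorem setIcRep_eq_integral_fQre : setIcRep = ∫ x in (0:ℝ)..1, fQre 1 0 2 x := by
  unfold setIcRep seqInsertion
  congr 1
  funext x
  rw [fQre_Ic]

/-- `setIbRep = ∫₀¹ F_{I(b)}`. -/
theorem setIbRep_eq_integral_fQre : setIbRep = ∫ x in (0:ℝ)..1, fQre 3 2 1 x := by
  unfold setIbRep
  rw [← intervalIntegral.integral_const_mul]
  congr 1
  funext x
  rw [fQre_Ib]
  ring

/-- `groupIbEightRep (= C₈) = ∫₀¹ F_{C₈}`. -/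
theorem groupIbEightRep_eq_integral_fQre : groupIbEightRep = ∫ x in (0:ℝ)..1, fQre 2 1 1 x := by
  unfold groupIbEightRep
  rw [← intervalIntegral.integral_const_mul]
  congr 1
  funext x
  rw [fQre_C8]
  ring

/-- `seqInsertion rho4 1 1 (= C₆) = ∫₀¹ F_{C₆}`. -/
theorem seqInsertion_rho4_one_one_eq_integral_fQre :
    seqInsertion rho4 1 1 = ∫ x in (0:ℝ)..1, fQre 1 0 1 x := by
  unfold seqInsertion
  congr 1
  funext x
  rw [fQre_C6, pow_one]

/-! ### Continuity on `(0,1)` and integrability on `[0,1]` -/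

/-- `K(x) = ∫₀¹ρ₂/W_t(x)` is continuous on `(0,1)` (trace of the analytic `kC`). -/
theorem continuousOn_K : ContinuousOn (fun x : ℝ => ∫ t in (0:ℝ)..1, rho2 t / wt t x 1) (Ioo 0 1) := by
  have hmaps : MapsTo (fun x : ℝ => (x : ℂ)) (Ioo 0 1) (Metric.ball (0 : ℂ) 1) := by
    intro x hx
    rw [Metric.mem_ball, dist_zero_right, Complex.norm_real, Real.norm_eq_abs, abs_of_pos hx.1]
    exact hx.2
  have h1 : ContinuousOn (fun x : ℝ => (kC (x : ℂ)).re) (Ioo 0 1) :=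
    Complex.continuous_re.comp_continuousOn
      (differentiableOn_kC.continuousOn.comp Complex.continuous_ofReal.continuousOn hmaps)
  refine h1.congr ?_
  intro x hx
  simp only
  rw [kC_ofReal hx.1 hx.2, Complex.ofReal_re]

/-- `J₄(x) = ∫₀¹ρ₄/W_t(x)` is continuous on `(0,1)` (trace of the analytic `jC`). -/
theorem continuousOn_J4 : ContinuousOn (fun x : ℝ => ∫ t in (0:ℝ)..1, rho4 t / wt t x 1) (Ioo 0 1) := by
  have hmaps : MapsTo (fun x : ℝ => (x : ℂ)) (Ioo 0 1) (Metric.ball (0 : ℂ) 1) := by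
    intro x hx
    rw [Metric.mem_ball, dist_zero_right, Complex.norm_real, Real.norm_eq_abs, abs_of_pos hx.1]
    exact hx.2
  have h1 : ContinuousOn (fun x : ℝ => (jC (x : ℂ)).re) (Ioo 0 1) :=
    Complex.continuous_re.comp_continuousOn
      (differentiableOn_jC.continuousOn.comp Complex.continuous_ofReal.continuousOn hmaps)
  refine h1.congr ?_
  intro x hx
  simp only
  rw [jC_ofReal hx.1 hx.2, Complex.ofReal_re]

/-- `F_Q` is continuous on `(0,1)`. -/
theorem continuousOn_fQre (cQ : ℝ) (m n : ℕ) : ContinuousOn (fQre cQ m n) (Ioo 0 1) := by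
  unfold fQre
  exact ((continuousOn_const.mul (continuousOn_const.sub continuousOn_id)).mul
    (continuousOn_K.pow m)).mul (continuousOn_J4.pow n)

/-- **`F_Q` is interval-integrable on `[0,1]`** (`0 ≤ c_Q`): dominated by the integrable
`c(1/3)^m(19/2)^n(1−x)lnᴺ(1/(1−x))` of file 5. -/
theorem intervalIntegrable_fQre {cQ : ℝ} (hc : 0 ≤ cQ) (m n : ℕ) :
    IntervalIntegrable (fQre cQ m n) volume 0 1 := by
  have hg := (intervalIntegrable_endPiece_logpow (m + n) one_pos le_rfl).const_mul
    (cQ * (1 / 3) ^ m * (19 / 2) ^ n)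
  simp only [sub_self] at hg
  refine IntervalIntegrable.mono_fun' hg ?_ ?_
  · -- measurability on Ι 0 1 = Ioc 0 1, from continuity on Ioo 0 1 (the point 1 is null)
    have h : AEStronglyMeasurable (fQre cQ m n) (volume.restrict (Ioo (0:ℝ) 1)) :=
      (continuousOn_fQre cQ m n).aestronglyMeasurable measurableSet_Ioo
    rw [uIoc_of_le zero_le_one, ← Measure.restrict_congr_set Ioo_ae_eq_Ioc]
    exact h
  · rw [uIoc_of_le zero_le_one, Filter.EventuallyLE, ae_restrict_iff' measurableSet_Ioc]
    refine Filter.Eventually.of_forall fun x hx => ?_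
    rcases eq_or_lt_of_le hx.2 with h | h
    · subst h; simp [fQre]
    · have := abs_fQre_le_logpow hc m n hx.1 h
      rw [Real.norm_eq_abs]
      calc |fQre cQ m n x| ≤ cQ * (1 - x) * (1 / 3) ^ m * (19 / 2) ^ n * log (1 / (1 - x)) ^ (m + n) := this
        _ = cQ * (1 / 3) ^ m * (19 / 2) ^ n * ((1 - x) * log (1 / (1 - x)) ^ (m + n)) := by ring

/-- `F_Q` is interval-integrable on every `[a,b] ⊆ [0,1]`. -/
theorem intervalIntegrable_fQre_of_mem {cQ : ℝ} (hc : 0 ≤ cQ) (m n : ℕ) {a b : ℝ}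
    (ha : a ∈ Icc (0:ℝ) 1) (hb : b ∈ Icc (0:ℝ) 1) :
    IntervalIntegrable (fQre cQ m n) volume a b := by
  refine (intervalIntegrable_fQre hc m n).mono_set ?_
  rw [Set.uIcc_of_le zero_le_one]
  exact Set.uIcc_subset_Icc ha hb

/-! ### Partition of `[0,1]` -/

/-- **Additivity over any chain in `[0,1]`**: if `a₀ = 0`, `a_K = 1` and all `a_k ∈ [0,1]`, then
`∫₀¹ F_Q = Σ_{k<K} ∫_{a_k}^{a_{k+1}} F_Q`. -/
theorem integral_fQre_eq_sum {cQ : ℝ} (hc : 0 ≤ cQ) (m n : ℕ) (a : ℕ → ℝ) (K : ℕ) (h0 : a 0 = 0)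
    (hK : a K = 1) (hmem : ∀ k ≤ K, a k ∈ Icc (0:ℝ) 1) :
    ∫ x in (0:ℝ)..1, fQre cQ m n x = ∑ k ∈ range K, ∫ x in a k..a (k + 1), fQre cQ m n x := by
  rw [← h0, ← hK]
  refine (intervalIntegral.sum_integral_adjacent_intervals ?_).symm
  intro k hk
  exact intervalIntegrable_fQre_of_mem hc m n (hmem k hk.le) (hmem (k + 1) hk)

/-- The certificate's dyadic chain (gl_bounds.md §3.1 with `J` sub-intervals + end piece): `a_k = 1 − 2^{−k}` for
`k ≤ J`, then `a_{J+1} = 1`; so `[a₀,a₁] = [0,½]`, `[a_{k−1},a_k] = [1−2^{1−k}, 1−2^{−k}]`, `[a_J, a_{J+1}] =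
[1−2^{−J}, 1]`. -/
def dyadicPt (J k : ℕ) : ℝ := if k ≤ J then 1 - (1 / 2) ^ k else 1

/-- `a₀ = 0`. -/
theorem dyadicPt_zero (J : ℕ) : dyadicPt J 0 = 0 := by simp [dyadicPt]

/-- `a_{J+1} = 1`. -/
theorem dyadicPt_succ (J : ℕ) : dyadicPt J (J + 1) = 1 := by simp [dyadicPt]

/-- `a_k = 1 − 2^{−k}` for `k ≤ J`. -/
theorem dyadicPt_of_le {J k : ℕ} (hk : k ≤ J) : dyadicPt J k = 1 - (1 / 2) ^ k := by simp [dyadicPt, hk]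

/-- Every `a_k` lies in `[0,1]`. -/
theorem dyadicPt_mem (J k : ℕ) : dyadicPt J k ∈ Icc (0:ℝ) 1 := by
  unfold dyadicPt
  split_ifs
  · have h1 : (0:ℝ) ≤ (1 / 2) ^ k := by positivity
    have h2 : ((1:ℝ) / 2) ^ k ≤ 1 := pow_le_one₀ (by norm_num) (by norm_num)
    constructor <;> linarith
  · simp

/-- **The typed Set I(c) over the certificate's partition**:
`setIcRep = Σ_{k ≤ J} ∫_{a_k}^{a_{k+1}} (1−x)J₄(x)² dx` (each summand: `gl_remainder_Ic` for `k < J`, `endPiece_Ic`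
for `k = J`). -/
theorem setIcRep_eq_sum_dyadic (J : ℕ) :
    setIcRep = ∑ k ∈ range (J + 1), ∫ x in dyadicPt J k..dyadicPt J (k + 1),
      (1 - x) * (∫ t in (0:ℝ)..1, rho4 t / wt t x 1) ^ 2 := by
  rw [setIcRep_eq_integral_fQre, integral_fQre_eq_sum zero_le_one 0 2 (dyadicPt J) (J + 1) (dyadicPt_zero J)
    (dyadicPt_succ J) (fun k _ => dyadicPt_mem J k)]
  refine Finset.sum_congr rfl fun k _ => ?_
  congr 1
  funext x
  rw [fQre_Ic]

/-- **The typed Set I(b) over the certificate's partition.** -/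
theorem setIbRep_eq_sum_dyadic (J : ℕ) :
    setIbRep = ∑ k ∈ range (J + 1), ∫ x in dyadicPt J k..dyadicPt J (k + 1),
      3 * (1 - x) * (∫ t in (0:ℝ)..1, rho2 t / wt t x 1) ^ 2 * (∫ t in (0:ℝ)..1, rho4 t / wt t x 1) := by
  rw [setIbRep_eq_integral_fQre, integral_fQre_eq_sum (by norm_num) 2 1 (dyadicPt J) (J + 1) (dyadicPt_zero J)
    (dyadicPt_succ J) (fun k _ => dyadicPt_mem J k)]
  refine Finset.sum_congr rfl fun k _ => ?_
  congr 1
  funext x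
  rw [fQre_Ib]

/-- **The typed control C₈ over the certificate's partition.** -/
theorem groupIbEightRep_eq_sum_dyadic (J : ℕ) :
    groupIbEightRep = ∑ k ∈ range (J + 1), ∫ x in dyadicPt J k..dyadicPt J (k + 1),
      2 * (1 - x) * (∫ t in (0:ℝ)..1, rho2 t / wt t x 1) * (∫ t in (0:ℝ)..1, rho4 t / wt t x 1) := by
  rw [groupIbEightRep_eq_integral_fQre, integral_fQre_eq_sum (by norm_num) 1 1 (dyadicPt J) (J + 1)
    (dyadicPt_zero J) (dyadicPt_succ J) (fun k _ => dyadicPt_mem J k)]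
  refine Finset.sum_congr rfl fun k _ => ?_
  congr 1
  funext x
  rw [fQre_C8]

/-- **The typed C₆ (= the sixth-order Källén–Sabry insertion integral) over the certificate's partition.** -/
theorem seqInsertion_rho4_one_one_eq_sum_dyadic (J : ℕ) :
    seqInsertion rho4 1 1 = ∑ k ∈ range (J + 1), ∫ x in dyadicPt J k..dyadicPt J (k + 1),
      (1 - x) * (∫ t in (0:ℝ)..1, rho4 t / wt t x 1) := by
  rw [seqInsertion_rho4_one_one_eq_integral_fQre, integral_fQre_eq_sum zero_le_one 0 1 (dyadicPt J) (J + 1)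
    (dyadicPt_zero J) (dyadicPt_succ J) (fun k _ => dyadicPt_mem J k)]
  refine Finset.sum_congr rfl fun k _ => ?_
  congr 1
  funext x
  rw [fQre_C6]

end Summit.Ventures.QEDPrecision.SpectralMajorants

end
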